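import Literature.Probability.RandomPlanarGeometry.LoewnerDriverUniformStability
import Literature.Probability.RandomPlanarGeometry.LoewnerPointFlow
import Literature.Probability.RandomPlanarGeometry.ConformalRectangle
import HarnessLib

/-!
# `stub_detMb` — conformal height of far points survives a sup-norm perturbation of the driver
(crux `PathUpgradeR`, stmt-CriticalPhenomena-18055, route `SAWReversalUpgrade`,
line `bidir_windows`)

Landing target:
`Summits/CriticalPhenomena/SAWScalingLimit/Theorems/SAWReversalUpgradePathUpgradeRDetMb.lean`
(`--supports stmt-CriticalPhenomena-18055`; registered stub `stub_detMb`).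

A DETERMINISTIC Loewner-chain lemma. Let `ψ : ℍ ≃ E` be a conformal equivalence onto a Dobrushin
domain, `V` a continuous driver, `T` a time, `d', h₀ > 0`, and `S ⊇ ∂E` a set of obstacles (in the
registered statement `S = ψ̄(γ[0, T+1]) ∪ ∂E`). Call `e ∈ E` *far* if `infDist e S ≥ d'`, and
suppose every far `e` has `T < T_{ψ⁻¹ e}^{V}` and `Im g^{V}_T(ψ⁻¹ e) ≥ 2 h₀`. Then there is
`δ₀ > 0` such that for every continuous driver `U` with `|U - V| ≤ δ₀` on `[0, T]`, every `t₁ ≤ T`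
and every far `e`: `ψ⁻¹ e ∈ H^{U}_{t₁}` and `Im g^{U}_{t₁}(ψ⁻¹ e) ≥ h₀`.

Proof (sub-namespace `PathUpgradeRDetMb`). The far set `F = closure E ∩ {infDist · S ≥ d'}` is
compact (closed and bounded) and contained in `E` (a point of `closure E \ E = ∂E ⊆ S` has
`infDist = 0 < d'`), so `K = ψ⁻¹(F) ⊆ ℍ` is compact (`ψ⁻¹` is continuous on `E`) and flows beyond
`T` for `V`. The Kemppainen–Smirnov perturbation lemma
(`Loewner.exists_forall_dist_map_le_of_driving_close`, [KS17, App. A, Lemma 5.4]) on `(K, T, h₀)`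
gives `δ₀`: for `U` `δ₀`-close to `V` on `[0, T]` every `z ∈ K` flows beyond `T` for `U` with
`dist (g^{U}_T z) (g^{V}_T z) ≤ h₀`; hence `z ∈ H^{U}_{t₁}` for `t₁ ≤ T`, and
`Im g^{U}_{t₁} z ≥ Im g^{U}_T z ≥ Im g^{V}_T z - h₀ ≥ h₀` (`Loewner.im_map_le_im_map`, Lawler (2005)
eq. (4.5)).
-/

noncomputable section

open scoped NNReal Topology
open Set Metric
open Literature.Probability.RandomPlanarGeometry Literature.Probability.RandomPlanarGeometry.Loewner
open UpperHalfPlane (upperHalfPlaneSet)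

namespace Summit.CriticalPhenomena.SAWScalingLimit.Theorems

namespace PathUpgradeRDetMb

/-- The **far set is compact and inside the domain**: for a Jordan domain `E`, a set `S ⊇ ∂E` and
`d' > 0`, the set `F = closure E ∩ {e | d' ≤ infDist e S}` is compact, and it is contained in `E`
(points of `closure E \ E` lie on `∂E ⊆ S`, at `infDist` zero). [folklore] -/
theorem isCompact_far_and_subset (E : JordanDomain) {S : Set ℂ} (hS : frontier E.carrier ⊆ S)
    {d' : ℝ} (hd' : 0 < d') :
    IsCompact (closure E.carrier ∩ {e | d' ≤ infDist e S}) ∧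
      closure E.carrier ∩ {e | d' ≤ infDist e S} ⊆ E.carrier := by
  refine ⟨isCompact_of_isClosed_isBounded
      (isClosed_closure.inter (isClosed_le continuous_const (continuous_infDist_pt S)))
      (E.isBounded.closure.subset inter_subset_left), fun e he ↦ ?_⟩
  have he' : e ∈ E.carrier ∪ frontier E.carrier := by
    rw [← closure_eq_self_union_frontier]; exact he.1
  rcases he' with h | h
  · exact h
  · have h0 : infDist e S = 0 := infDist_zero_of_mem (hS h)
    have := he.2
    rw [mem_setOf_eq, h0] at this
    exact absurd this (not_le.2 hd')

/-- **Conformal height of far points survives a perturbation of the driver** (general obstacle set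
`S ⊇ ∂E`, closeness on `[0, T]`): if every `e ∈ E` with `infDist e S ≥ d'` has `T < T^{V}_{ψ⁻¹ e}`
and `Im g^{V}_T(ψ⁻¹ e) ≥ 2h₀`, then for some `δ₀ > 0`, every continuous `U` with `|U - V| ≤ δ₀` on
`[0, T]`, every `t₁ ≤ T` and every such `e` satisfy `ψ⁻¹ e ∈ H^{U}_{t₁}` and
`Im g^{U}_{t₁}(ψ⁻¹ e) ≥ h₀` (Kemppainen–Smirnov perturbation lemma on the compact set `ψ⁻¹(far set)`,
then monotonicity of `Im g_t`). [cite: KemppainenSmirnov2017, App. A, Lemma 5.4] -/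
theorem exists_forall_mem_domain_and_le_im_map {E : DobrushinDomain}
    (ψ : ConformalEquiv upperHalfPlaneSet E.carrier) {V : ℝ≥0 → ℝ} (hV : Continuous V) {T : ℝ≥0}
    {S : Set ℂ} (hS : frontier E.carrier ⊆ S) {d' h₀ : ℝ} (hd' : 0 < d') (hh₀ : 0 < h₀)
    (hfar : ∀ e ∈ E.carrier, d' ≤ infDist e S →
      (T : WithTop ℝ≥0) < swallowingTime V (ψ.symm e) ∧ 2 * h₀ ≤ (map V T (ψ.symm e)).im) :
    ∃ δ₀ : ℝ, 0 < δ₀ ∧ ∀ U : ℝ≥0 → ℝ, Continuous U → (∀ s : ℝ≥0, s ≤ T → |U s - V s| ≤ δ₀) →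
      ∀ t₁ : ℝ≥0, t₁ ≤ T → ∀ e ∈ E.carrier, d' ≤ infDist e S →
        ψ.symm e ∈ domain U t₁ ∧ h₀ ≤ (map U t₁ (ψ.symm e)).im := by
  obtain ⟨hF, hFE⟩ := isCompact_far_and_subset E.toJordanDomain hS hd'
  have hK : IsCompact (ψ.symm '' (closure E.carrier ∩ {e | d' ≤ infDist e S})) :=
    hF.image_of_continuousOn (ψ.symm.continuousOn.mono hFE)
  have hKb : ∀ z ∈ ψ.symm '' (closure E.carrier ∩ {e | d' ≤ infDist e S}),
      (T : WithTop ℝ≥0) < swallowingTime V z := by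
    rintro _ ⟨e, he, rfl⟩
    exact (hfar e (hFE he) he.2).1
  obtain ⟨η, hη, hclose⟩ := exists_forall_dist_map_le_of_driving_close hV hK hKb hh₀
  refine ⟨η, hη, fun U hU hUV t₁ ht₁ e he hed ↦ ?_⟩
  have hz : ψ.symm e ∈ ψ.symm '' (closure E.carrier ∩ {e | d' ≤ infDist e S}) :=
    mem_image_of_mem _ ⟨subset_closure he, hed⟩
  obtain ⟨hTU, hdist⟩ :=
    hclose U hU (fun s hs ↦ by rw [abs_sub_comm]; exact hUV s hs) _ hz
  have hzH : ψ.symm e ∈ upperHalfPlaneSet := ψ.symm_mapsTo he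
  have ht₁U : (t₁ : WithTop ℝ≥0) < swallowingTime U (ψ.symm e) :=
    lt_of_le_of_lt (WithTop.coe_le_coe.2 ht₁) hTU
  refine ⟨(mem_domain_iff U t₁ _).2 ⟨hzH, ht₁U⟩, ?_⟩
  have h1 : (map U T (ψ.symm e)).im ≤ (map U t₁ (ψ.symm e)).im := im_map_le_im_map hU hzH ht₁ hTU
  have h2 : dist (map U T (ψ.symm e)) (map V T (ψ.symm e)) ≤ h₀ := hdist T le_rfl
  have h3 : 2 * h₀ ≤ (map V T (ψ.symm e)).im := (hfar e he hed).2
  have h4 : |(map U T (ψ.symm e) - map V T (ψ.symm e)).im| ≤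
      ‖map U T (ψ.symm e) - map V T (ψ.symm e)‖ := Complex.abs_im_le_norm _
  rw [Complex.sub_im, ← dist_eq_norm] at h4
  have h5 := (abs_le.1 h4).1
  linarith

end PathUpgradeRDetMb

/-- **Conformal height of far points survives a sup-norm perturbation of the driver** (registered
stub `stub_detMb` of crux `PathUpgradeR`, line `bidir_windows`): for a chordal uniformizer `ψ` of a
Dobrushin domain `E`, a continuous driver `V` with trace `γ`, a horizon `T` and `d', h₀ > 0`, if
every point `e ∈ E` at distance `≥ d'` from `ψ̄(γ[0, T+1]) ∪ ∂E` has `T < T^{V}_{ψ⁻¹ e}` and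
`Im g^{V}_T(ψ⁻¹ e) ≥ 2h₀`, then some `δ₀ > 0` works for EVERY continuous driver `U` with
`|U - V| ≤ δ₀` on `[0, T+1]`: for all `t₁ ≤ T` and all such `e`, `ψ⁻¹ e ∈ H^{U}_{t₁}` and
`Im g^{U}_{t₁}(ψ⁻¹ e) ≥ h₀` (Kemppainen–Smirnov perturbation lemma on the compact preimage of the
far set, `PathUpgradeRDetMb.exists_forall_mem_domain_and_le_im_map`; the curve hypotheses are not
needed). [cite: KemppainenSmirnov2017, App. A, Lemma 5.4] -/
theorem stub_detMb : ∀ (E : Literature.Probability.RandomPlanarGeometry.DobrushinDomain) (ψ : Literature.Probability.RandomPlanarGeometry.ConformalEquiv UpperHalfPlane.upperHalfPlaneSet E.carrier), E.IsChordalUniformizing ψ → ∀ (V : NNReal → ℝ) (γ : NNReal → ℂ), Continuous V → Literature.Probability.RandomPlanarGeometry.Loewner.IsGeneratedByCurve V γ → Literature.Probability.RandomPlanarGeometry.Loewner.IsSimpleTrace γ → ∀ (T : NNReal), 0 < T → closure (Literature.Probability.RandomPlanarGeometry.Loewner.hull V T) = γ '' Set.Icc 0 T → ∀ (d' h₀ :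 ℝ), 0 < d' → 0 < h₀ → (∀ e ∈ E.carrier, d' ≤ Metric.infDist e ((fun u => ψ.boundaryExtension (γ u)) '' Set.Icc 0 (T + 1) ∪ frontier E.carrier) → ((T : NNReal) : WithTop NNReal) < Literature.Probability.RandomPlanarGeometry.Loewner.swallowingTime V (ψ.symm e) ∧ 2 * h₀ ≤ (Literature.Probability.RandomPlanarGeometry.Loewner.map V T (ψ.symm e)).im) → ∃ δ₀ : ℝ, 0 < δ₀ ∧ ∀ U : NNReal → ℝ, Continuous U → (∀ s : NNReal, (s : ℝ) ≤ T + 1 → |U s - V s| ≤ δ₀) → ∀ t₁ : NNReal, (t₁ : ℝ) ≤ T → ∀ e ∈ E.carrier, d' ≤ Metric.infDist e ((fun u => ψ.boundaryExtension (γ u)) '' Set.Icc 0 (T + 1) ∪ frontier E.carrier) → ψ.symm e ∈ Literature.Probability.RandomPlanarGeometry.Loewner.domain U t₁ ∧ h₀ ≤ (Literature.Probability.RandomPlanarGeometry.Loewner.map U t₁ (ψ.symm e)).im := by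
  intro E ψ _ V γ hV _ _ T _ _ d' h₀ hd' hh₀ hfar
  obtain ⟨δ₀, hδ₀, H⟩ :=
    PathUpgradeRDetMb.exists_forall_mem_domain_and_le_im_map ψ hV subset_union_right hd' hh₀ hfar
  refine ⟨δ₀, hδ₀, fun U hU hUV t₁ ht₁ e he hed ↦ H U hU (fun s hs ↦ hUV s ?_) t₁
    (NNReal.coe_le_coe.1 ht₁) e he hed⟩
  exact (NNReal.coe_le_coe.2 hs).trans (le_add_of_nonneg_right zero_le_one)

end Summit.CriticalPhenomena.SAWScalingLimit.Theorems

end
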